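import Summits.CriticalPhenomena.PercolationContinuityZ3.Theorems.Transplant.FreeNilpotentColumn
import HarnessLib

/-!
# Connectivity of the columns of `Cay(N_{m,2})` (and of the whole Cayley graph)

builds on p205010 (kernel theorem, internal audit signed; external expert review pending) — nothing in this file uses p205010.
Lane `prim-bschramm`, seat `prim-bschramm-p4` (gen 4; class map, memo `P4-GENERAL.md` §12), helper file
(`--supports stmt-CriticalPhenomena-4575`).  Fourth file of the `FreeNilpotent*` series.

`G[Σ]`, `Σ = fnCol i₀ L = {|v_i| ≤ L, i ≠ i₀}`, is connected for `L ≥ 1`: from `1`, straight generator segments (one coordinate at a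
time, `col_exists_reach_fst`) reach SOME point over every admissible `v`; then signed commutator 4-cycles
`e_a^{σ} e_b^{τ} e_a^{−σ} e_b^{−τ} = E_{(a,b)}^{στ}` (`comm_signed`), run with the signs pointing INTO the column (`sgnIn`, possible as
`L ≥ 1`), adjust every central coordinate without moving `v` (`col_reach_central`, `col_reach_snd`).  Consequences:
`fnColGraph_connected`, and `fnGraph_connected` (every vertex lies in some column).
[cite: BenjaminiSchramm1996, §2 (Cayley graphs)] [cite: MartineauSevero2019, Cor. 2.2 (hypothesis: connected graph)]
-/

noncomputable section

namespace Summit.CriticalPhenomena.PercolationContinuityZ3.Theorems.Transplant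

open MeasureTheory Literature.Probability.Percolation Literature.Probability.LatticeModels SimpleGraph

variable {m : ℕ} {i₀ : Fin m} {L : ℕ}

/-! ## §1 Steps and segments inside the column -/

/-- A generator step that stays in the column is an edge of the column graph. [folklore] -/
theorem col_step {u : FN m} (hu : u ∈ fnCol i₀ L) {s : FN m} (hs : s ∈ fnGens m) (hv : fnMul u s ∈ fnCol i₀ L) :
    (fnColGraph i₀ L).Reachable ⟨u, hu⟩ ⟨fnMul u s, hv⟩ := by
  refine SimpleGraph.Adj.reachable ?_
  rw [SimpleGraph.comap_adj, Function.Embedding.coe_subtype]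
  exact fnGraph_adj_mul_gen u hs

/-- Transport of a reachability target along an equality of vertices. [folklore] -/
theorem col_reach_of_eq {x : fnCol i₀ L} {v v' : FN m} {hv : v ∈ fnCol i₀ L} (h : v = v')
    (hr : (fnColGraph i₀ L).Reachable x ⟨v, hv⟩) : (fnColGraph i₀ L).Reachable x ⟨v', h ▸ hv⟩ := by
  subst h; exact hr

/-- `k(1, 0) = e_i`. [folklore] -/
theorem kElt_one (i : Fin m) : kElt i 1 0 = (fnGen i : FN m) := rfl

/-- `k(−1, 0) = e_i⁻¹`. [folklore] -/
theorem kElt_neg_one (i : Fin m) : kElt i (-1) 0 = (fnGenInv i : FN m) :=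
  Prod.ext (Pi.single_neg (f := fun _ : Fin m => ℤ) i (1 : ℤ)) rfl

/-- `k(0, 0) = 1`. [folklore] -/
theorem kElt_zero (i : Fin m) : kElt i 0 0 = (0 : FN m) := Prod.ext (Pi.single_zero i) rfl

/-- `k(σ, 0) ∈ S` for `σ = ±1`. [folklore] -/
theorem kElt_mem_fnGens (i : Fin m) {σ : ℤ} (hσ : σ = 1 ∨ σ = -1) : kElt i σ 0 ∈ fnGens m := by
  rcases hσ with rfl | rfl
  · rw [kElt_one]; exact fnGen_mem_fnGens i
  · rw [kElt_neg_one]; exact fnGenInv_mem_fnGens i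

/-- Skeleton coordinates of `u · k_i(t, 0)`: `v_i ↦ v_i + t`, others kept. [folklore] -/
theorem fnMul_kElt_right_fst (u : FN m) (i : Fin m) (t : ℤ) (j : Fin m) :
    (fnMul u (kElt i t 0)).1 j = u.1 j + if j = i then t else 0 := by
  simp [kElt, Pi.single_apply]

/-- Betweenness: if `u, u·e_i^t ∈ Σ` then `u·e_i^{t'} ∈ Σ` for `t'` between `0` and `t`. [folklore] -/
theorem mem_fnCol_between {u : FN m} (hu : u ∈ fnCol i₀ L) (i : Fin m) {t t' : ℤ}
    (hbt : (0 ≤ t' ∧ t' ≤ t) ∨ (t ≤ t' ∧ t' ≤ 0)) (ht : fnMul u (kElt i t 0) ∈ fnCol i₀ L) :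
    fnMul u (kElt i t' 0) ∈ fnCol i₀ L := by
  intro j hj
  have h0 := hu j hj
  have h1 := ht j hj
  rw [fnMul_kElt_right_fst] at h1 ⊢
  by_cases hji : j = i
  · rw [if_pos hji] at h1 ⊢
    rw [abs_le] at h0 h1 ⊢
    rcases hbt with ⟨h2, h3⟩ | ⟨h2, h3⟩ <;> constructor <;> linarith
  · rw [if_neg hji] at h1 ⊢; exact h1

/-- **Straight segments**: from `u ∈ Σ` to `u · e_i^t ∈ Σ` inside the column. [folklore] -/
theorem col_reach_segment (u : FN m) (hu : u ∈ fnCol i₀ L) (i : Fin m) :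
    ∀ (t : ℤ) (ht : fnMul u (kElt i t 0) ∈ fnCol i₀ L), (fnColGraph i₀ L).Reachable ⟨u, hu⟩ ⟨fnMul u (kElt i t 0), ht⟩ := by
  intro t
  induction t using Int.induction_on with
  | zero =>
    intro ht
    have e : u = fnMul u (kElt i 0 0) := by rw [kElt_zero, fnMul_zero]
    exact col_reach_of_eq e (Reachable.refl _)
  | succ n ih =>
    intro ht
    have hn : fnMul u (kElt i (n : ℤ) 0) ∈ fnCol i₀ L :=
      mem_fnCol_between hu i (Or.inl ⟨by positivity, by linarith⟩) ht
    have e : fnMul (fnMul u (kElt i (n : ℤ) 0)) (kElt i 1 0) = fnMul u (kElt i ((n : ℤ) + 1) 0) := by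
      rw [fnMul_assoc, kElt_mul, add_zero]
    exact (ih hn).trans (col_reach_of_eq e (col_step hn (kElt_mem_fnGens i (Or.inl rfl)) (e ▸ ht)))
  | pred n ih =>
    intro ht
    have hn : fnMul u (kElt i (-(n : ℤ)) 0) ∈ fnCol i₀ L :=
      mem_fnCol_between hu i (Or.inr ⟨by linarith, by simp⟩) ht
    have e : fnMul (fnMul u (kElt i (-(n : ℤ)) 0)) (kElt i (-1) 0) = fnMul u (kElt i (-(n : ℤ) - 1) 0) := by
      rw [fnMul_assoc, kElt_mul, add_zero, sub_eq_add_neg]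
    exact (ih hn).trans (col_reach_of_eq e (col_step hn (kElt_mem_fnGens i (Or.inr rfl)) (e ▸ ht)))

/-- **Some point over every admissible `v` is reachable from `1` inside the column** (one coordinate at a time). [folklore] -/
theorem col_exists_reach_fst (S : Finset (Fin m)) :
    ∀ v : Fin m → ℤ, (∀ i, i ∉ S → v i = 0) → (∀ i, i ≠ i₀ → |v i| ≤ L) →
      ∃ (c : Pr m → ℤ) (h : ((v, c) : FN m) ∈ fnCol i₀ L), (fnColGraph i₀ L).Reachable (fnColOrigin i₀ L) ⟨(v, c), h⟩ := by
  classical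
  induction S using Finset.induction_on with
  | empty =>
    intro v hv _
    have hv0 : v = 0 := funext fun i => hv i (Finset.notMem_empty i)
    subst hv0
    exact ⟨0, zero_mem_fnCol i₀ L, Reachable.refl _⟩
  | insert i S hi ih =>
    intro v hv hb
    obtain ⟨c', h', hr'⟩ := ih (Function.update v i 0) (fun j hj => by
        by_cases hji : j = i
        · subst hji; simp
        · rw [Function.update_of_ne hji]; exact hv j (by simp [hji, hj]))
      (fun j hj => by
        by_cases hji : j = i
        · subst hji; simp
        · rw [Function.update_of_ne hji]; exact hb j hj)
    have hend_fst : (fnMul ((Function.update v i 0, c') : FN m) (kElt i (v i) 0)).1 = v := by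
      funext j
      rw [fnMul_kElt_right_fst]
      dsimp only
      by_cases hji : j = i
      · subst hji; simp
      · rw [if_neg hji, add_zero, Function.update_of_ne hji]
    have hvmem : ((v, (fnMul ((Function.update v i 0, c') : FN m) (kElt i (v i) 0)).2) : FN m) ∈ fnCol i₀ L :=
      fun j hj => hb j hj
    have hend : fnMul ((Function.update v i 0, c') : FN m) (kElt i (v i) 0) ∈ fnCol i₀ L :=
      mem_fnCol_of_fst_eq hend_fst hvmem
    refine ⟨(fnMul ((Function.update v i 0, c') : FN m) (kElt i (v i) 0)).2, hvmem, ?_⟩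
    have e : fnMul ((Function.update v i 0, c') : FN m) (kElt i (v i) 0) =
        (v, (fnMul ((Function.update v i 0, c') : FN m) (kElt i (v i) 0)).2) := Prod.ext hend_fst rfl
    exact col_reach_of_eq e (hr'.trans (col_reach_segment _ h' i (v i) hend))

/-! ## §2 Signed commutator 4-cycles: adjusting the centre without moving the skeleton coordinates -/

/-- Skeleton part of the 4-cycle word cancels. [folklore] -/
theorem cycle_fst_eq_zero (a b : Fin m) (σ τ : ℤ) :
    (Pi.single a σ + Pi.single b τ + Pi.single a (-σ) + Pi.single b (-τ) : Fin m → ℤ) = 0 := by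
  funext j
  simp only [Pi.add_apply, Pi.single_apply, Pi.zero_apply]
  split_ifs <;> ring

/-- **`e_a^σ e_b^τ e_a^{−σ} e_b^{−τ} = E_{(a,b)}^{στ}`** for `a < b` (any integers `σ, τ`; used with `±1`). [folklore] -/
theorem comm_signed (a b : Fin m) (hab : a < b) (σ τ : ℤ) :
    fnMul (fnMul (fnMul (kElt a σ 0) (kElt b τ 0)) (kElt a (-σ) 0)) (kElt b (-τ) 0) =
      (((0 : Fin m → ℤ), Pi.single ⟨(a, b), hab⟩ (σ * τ)) : FN m) := by
  refine Prod.ext ?_ ?_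
  · simp only [fnMul_fst, kElt]; exact cycle_fst_eq_zero a b σ τ
  · simp only [fnMul_snd, fnMul_fst, kElt, fnBeta_add_left, fnBeta_single_single_self]
    rw [fnBeta_single_single a b σ τ hab, fnBeta_single_single a b σ (-τ) hab, fnBeta_single_single a b (-σ) (-τ) hab,
      fnBeta_single_single_rev a b τ (-σ) hab]
    simp only [add_zero, zero_add]
    rw [← Pi.single_add, ← Pi.single_add]
    congr 1; ring

/-- **The cycle in the other order, `e_b^τ e_a^σ e_b^{−τ} e_a^{−σ} = E_{(a,b)}^{−στ}`** (`a < b`). [folklore] -/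
theorem comm_signed_rev (a b : Fin m) (hab : a < b) (σ τ : ℤ) :
    fnMul (fnMul (fnMul (kElt b τ 0) (kElt a σ 0)) (kElt b (-τ) 0)) (kElt a (-σ) 0) =
      (((0 : Fin m → ℤ), Pi.single ⟨(a, b), hab⟩ (-(σ * τ))) : FN m) := by
  refine Prod.ext ?_ ?_
  · simp only [fnMul_fst, kElt]; exact cycle_fst_eq_zero b a τ σ
  · simp only [fnMul_snd, fnMul_fst, kElt, fnBeta_add_left, fnBeta_single_single_self]
    rw [fnBeta_single_single_rev a b τ σ hab, fnBeta_single_single a b σ (-τ) hab, fnBeta_single_single_rev a b τ (-σ) hab,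
      fnBeta_single_single_rev a b (-τ) (-σ) hab]
    simp only [add_zero, zero_add]
    congr 1; ring

/-- The inward sign at a coordinate value: `−1` if `a ≥ 0`, `+1` if `a < 0`. [folklore] -/
def sgnIn (a : ℤ) : ℤ := if 0 ≤ a then -1 else 1

/-- `sgnIn a = ±1`. [folklore] -/
theorem sgnIn_eq (a : ℤ) : sgnIn a = 1 ∨ sgnIn a = -1 := by
  unfold sgnIn; split_ifs <;> simp

/-- Moving inward keeps `|a + sgnIn a| ≤ L` when `|a| ≤ L` and `L ≥ 1`. [folklore] -/
theorem abs_add_sgnIn_le (hL : 1 ≤ L) {a : ℤ} (ha : |a| ≤ L) : |a + sgnIn a| ≤ L := by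
  have hL' : (1 : ℤ) ≤ L := by exact_mod_cast hL
  unfold sgnIn
  rw [abs_le] at ha ⊢
  split_ifs with h <;> constructor <;> linarith [ha.1, ha.2]

/-- `σ τ = ±1` for signs `σ, τ = ±1`. [folklore] -/
theorem sign_mul_eq {σ τ : ℤ} (hσ : σ = 1 ∨ σ = -1) (hτ : τ = 1 ∨ τ = -1) : σ * τ = 1 ∨ σ * τ = -1 := by
  rcases hσ with rfl | rfl <;> rcases hτ with rfl | rfl <;> simp

/-- `−σ = ±1` for `σ = ±1`. [folklore] -/
theorem neg_sign_eq {σ : ℤ} (hσ : σ = 1 ∨ σ = -1) : -σ = 1 ∨ -σ = -1 := by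
  rcases hσ with rfl | rfl <;> simp

/-- Membership of a point whose skeleton coordinates differ from `u`'s by `α` at `a` and `β` at `b` only. [folklore] -/
theorem mem_fnCol_of_two {u : FN m} (hu : u ∈ fnCol i₀ L) {a b : Fin m} (hab : a ≠ b) {α β : ℤ}
    (ha : a ≠ i₀ → |u.1 a + α| ≤ L) (hb : b ≠ i₀ → |u.1 b + β| ≤ L) {w : FN m}
    (hw : ∀ j, w.1 j = u.1 j + (if j = a then α else 0) + (if j = b then β else 0)) : w ∈ fnCol i₀ L := by
  intro j hj
  rw [hw j]
  by_cases hja : j = a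
  · subst hja; rw [if_pos rfl, if_neg hab, add_zero]; exact ha hj
  · by_cases hjb : j = b
    · subst hjb; rw [if_neg hja, if_pos rfl, add_zero]; exact hb hj
    · rw [if_neg hja, if_neg hjb, add_zero, add_zero]; exact hu j hj

/-- **The signed 4-cycle `u → u e_a^σ → u e_a^σ e_b^τ → u e_a^σ e_b^τ e_a^{−σ} → u e_a^σ e_b^τ e_a^{−σ} e_b^{−τ}` runs inside the column**
whenever the two excursions `u_a + σ`, `u_b + τ` stay within the bounds. [folklore] -/
theorem col_reach_cycle {u : FN m} (hu : u ∈ fnCol i₀ L) {a b : Fin m} (hab : a ≠ b) {σ τ : ℤ}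
    (hσ : σ = 1 ∨ σ = -1) (hτ : τ = 1 ∨ τ = -1) (ha : a ≠ i₀ → |u.1 a + σ| ≤ L) (hb : b ≠ i₀ → |u.1 b + τ| ≤ L)
    (hend : fnMul u (fnMul (fnMul (fnMul (kElt a σ 0) (kElt b τ 0)) (kElt a (-σ) 0)) (kElt b (-τ) 0)) ∈ fnCol i₀ L) :
    (fnColGraph i₀ L).Reachable ⟨u, hu⟩
      ⟨fnMul u (fnMul (fnMul (fnMul (kElt a σ 0) (kElt b τ 0)) (kElt a (-σ) 0)) (kElt b (-τ) 0)), hend⟩ := by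
  have ha0 : a ≠ i₀ → |u.1 a + 0| ≤ L := fun h => by rw [add_zero]; exact hu a h
  have hb0 : b ≠ i₀ → |u.1 b + 0| ≤ L := fun h => by rw [add_zero]; exact hu b h
  have m1 : fnMul u (kElt a σ 0) ∈ fnCol i₀ L :=
    mem_fnCol_of_two hu hab ha hb0 fun j => by simp only [fnMul_kElt_right_fst]; split_ifs <;> ring
  have m2 : fnMul (fnMul u (kElt a σ 0)) (kElt b τ 0) ∈ fnCol i₀ L :=
    mem_fnCol_of_two hu hab ha hb fun j => by simp only [fnMul_kElt_right_fst]
  have m3 : fnMul (fnMul (fnMul u (kElt a σ 0)) (kElt b τ 0)) (kElt a (-σ) 0) ∈ fnCol i₀ L :=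
    mem_fnCol_of_two hu hab ha0 hb fun j => by simp only [fnMul_kElt_right_fst]; split_ifs <;> ring
  have e : fnMul (fnMul (fnMul (fnMul u (kElt a σ 0)) (kElt b τ 0)) (kElt a (-σ) 0)) (kElt b (-τ) 0) =
      fnMul u (fnMul (fnMul (fnMul (kElt a σ 0) (kElt b τ 0)) (kElt a (-σ) 0)) (kElt b (-τ) 0)) := by
    simp only [fnMul_assoc]
  have m4 : fnMul (fnMul (fnMul (fnMul u (kElt a σ 0)) (kElt b τ 0)) (kElt a (-σ) 0)) (kElt b (-τ) 0) ∈ fnCol i₀ L := by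
    rw [e]; exact hend
  exact col_reach_of_eq e ((((col_step hu (kElt_mem_fnGens a hσ) m1).trans (col_step m1 (kElt_mem_fnGens b hτ) m2)).trans
    (col_step m2 (kElt_mem_fnGens a (neg_sign_eq hσ)) m3)).trans (col_step m3 (kElt_mem_fnGens b (neg_sign_eq hτ)) m4))

section Loops

variable (hL : 1 ≤ L)
include hL

/-- **Both central unit steps `±E_{(a,b)}` are reachable from `u ∈ Σ` inside the column** (signed commutator cycles with inward
signs, in the two orders). [folklore] -/
theorem col_reach_central_unit {u : FN m} (hu : u ∈ fnCol i₀ L) (p : Pr m) (s : ℤ) (hs : s = 1 ∨ s = -1) :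
    (fnColGraph i₀ L).Reachable ⟨u, hu⟩
      ⟨fnMul u ((0 : Fin m → ℤ), Pi.single p s), mem_fnCol_of_fst_eq (by simp) hu⟩ := by
  obtain ⟨⟨a, b⟩, hab⟩ := p
  have hne : a ≠ b := ne_of_lt hab
  have hσ := sgnIn_eq (u.1 a)
  have hτ := sgnIn_eq (u.1 b)
  have ha : a ≠ i₀ → |u.1 a + sgnIn (u.1 a)| ≤ L := fun h => abs_add_sgnIn_le hL (hu a h)
  have hb : b ≠ i₀ → |u.1 b + sgnIn (u.1 b)| ≤ L := fun h => abs_add_sgnIn_le hL (hu b h)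
  have hmem : ∀ k : ℤ, fnMul u ((0 : Fin m → ℤ), Pi.single ⟨(a, b), hab⟩ k) ∈ fnCol i₀ L :=
    fun k => mem_fnCol_of_fst_eq (by simp) hu
  -- cycle in the order (a, b): reaches `u · E^{στ}`; in the order (b, a): reaches `u · E^{−στ}`
  have e1 := comm_signed a b hab (sgnIn (u.1 a)) (sgnIn (u.1 b))
  have e2 := comm_signed_rev a b hab (sgnIn (u.1 a)) (sgnIn (u.1 b))
  have r1 := col_reach_cycle hu hne hσ hτ ha hb (by rw [e1]; exact hmem _)
  have r2 := col_reach_cycle hu hne.symm hτ hσ hb ha (by rw [e2]; exact hmem _)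
  have r1' : (fnColGraph i₀ L).Reachable ⟨u, hu⟩
      ⟨fnMul u ((0 : Fin m → ℤ), Pi.single ⟨(a, b), hab⟩ (sgnIn (u.1 a) * sgnIn (u.1 b))), hmem _⟩ :=
    col_reach_of_eq (by rw [e1]) r1
  have r2' : (fnColGraph i₀ L).Reachable ⟨u, hu⟩
      ⟨fnMul u ((0 : Fin m → ℤ), Pi.single ⟨(a, b), hab⟩ (-(sgnIn (u.1 a) * sgnIn (u.1 b)))), hmem _⟩ :=
    col_reach_of_eq (by rw [e2]) r2
  rcases sign_mul_eq hσ hτ with h1 | h1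
  · rcases hs with rfl | rfl
    · exact col_reach_of_eq (by rw [h1]) r1'
    · exact col_reach_of_eq (by rw [h1]) r2'
  · rcases hs with rfl | rfl
    · exact col_reach_of_eq (by rw [h1, neg_neg]) r2'
    · exact col_reach_of_eq (by rw [h1]) r1'

/-- **Every central translate `u · E_p^k` is reachable from `u ∈ Σ` inside the column.** [folklore] -/
theorem col_reach_central {u : FN m} (hu : u ∈ fnCol i₀ L) (p : Pr m) (k : ℤ) :
    (fnColGraph i₀ L).Reachable ⟨u, hu⟩ ⟨fnMul u ((0 : Fin m → ℤ), Pi.single p k), mem_fnCol_of_fst_eq (by simp) hu⟩ := by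
  induction k using Int.induction_on with
  | zero =>
    exact col_reach_of_eq (by rw [Pi.single_zero, Prod.mk_zero_zero, fnMul_zero]) (Reachable.refl _)
  | succ n ih =>
    have hn : fnMul u ((0 : Fin m → ℤ), Pi.single p (n : ℤ)) ∈ fnCol i₀ L := mem_fnCol_of_fst_eq (by simp) hu
    have e : fnMul (fnMul u ((0 : Fin m → ℤ), Pi.single p (n : ℤ))) ((0 : Fin m → ℤ), Pi.single p 1) =
        fnMul u ((0 : Fin m → ℤ), Pi.single p ((n : ℤ) + 1)) := by
      rw [fnMul_assoc, fnMul_central_right]; simp [Pi.single_add]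
    exact ih.trans (col_reach_of_eq e (col_reach_central_unit hL hn p 1 (Or.inl rfl)))
  | pred n ih =>
    have hn : fnMul u ((0 : Fin m → ℤ), Pi.single p (-(n : ℤ))) ∈ fnCol i₀ L := mem_fnCol_of_fst_eq (by simp) hu
    have e : fnMul (fnMul u ((0 : Fin m → ℤ), Pi.single p (-(n : ℤ)))) ((0 : Fin m → ℤ), Pi.single p (-1)) =
        fnMul u ((0 : Fin m → ℤ), Pi.single p (-(n : ℤ) - 1)) := by
      rw [fnMul_assoc, fnMul_central_right, sub_eq_add_neg]; simp [Pi.single_add]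
    exact ih.trans (col_reach_of_eq e (col_reach_central_unit hL hn p (-1) (Or.inr rfl)))

/-- **Any two points of `Σ` over the same `v` are joined inside the column.** [folklore] -/
theorem col_reach_snd (v : Fin m → ℤ) (hv : ∀ i, i ≠ i₀ → |v i| ≤ L) (c c' : Pr m → ℤ) :
    (fnColGraph i₀ L).Reachable ⟨(v, c), fun i hi => hv i hi⟩ ⟨(v, c'), fun i hi => hv i hi⟩ := by
  classical
  -- induction on the set of central coordinates where `c` and the target may differ
  suffices h : ∀ (S : Finset (Pr m)) (c c' : Pr m → ℤ), (∀ p, p ∉ S → c p = c' p) →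
      (fnColGraph i₀ L).Reachable ⟨(v, c), fun i hi => hv i hi⟩ ⟨(v, c'), fun i hi => hv i hi⟩ from
    h Finset.univ c c' (fun p hp => absurd (Finset.mem_univ p) hp)
  intro S
  induction S using Finset.induction_on with
  | empty =>
    intro c c' hcc
    have : c = c' := funext fun p => hcc p (Finset.notMem_empty p)
    subst this; exact Reachable.refl _
  | insert p S hp ih =>
    intro c c' hcc
    have hmem : ((v, c) : FN m) ∈ fnCol i₀ L := fun i hi => hv i hi
    have e : fnMul ((v, c) : FN m) ((0 : Fin m → ℤ), Pi.single p (c' p - c p)) = (v, c + Pi.single p (c' p - c p)) := by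
      rw [fnMul_central_right]
    have r1 := col_reach_of_eq e (col_reach_central hL hmem p (c' p - c p))
    have hcc'' : ∀ q, q ∉ S → (c + Pi.single p (c' p - c p) : Pr m → ℤ) q = c' q := by
      intro q hq
      rw [Pi.add_apply]
      by_cases hqp : q = p
      · rw [hqp, Pi.single_eq_same]; ring
      · rw [Pi.single_eq_of_ne hqp, add_zero]
        exact hcc q (by simp [hqp, hq])
    exact r1.trans (ih _ c' hcc'')

/-- **Every column vertex is joined to `1` inside the column** (`L ≥ 1`). [folklore] -/
theorem col_reach_all (x : fnCol i₀ L) : (fnColGraph i₀ L).Reachable (fnColOrigin i₀ L) x := by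
  classical
  obtain ⟨⟨v, c⟩, hx⟩ := x
  have hv : ∀ i, i ≠ i₀ → |v i| ≤ L := hx
  obtain ⟨c₀, h₀, r₀⟩ := col_exists_reach_fst (i₀ := i₀) (L := L) Finset.univ v
    (fun i hi => absurd (Finset.mem_univ i) hi) hv
  exact r₀.trans (col_reach_snd hL v hv c₀ c)

/-- **The column graph `G[Σ]` is connected** (`L ≥ 1`). [cite: MartineauSevero2019, Cor. 2.2 (hypothesis)] -/
theorem fnColGraph_connected : (fnColGraph i₀ L).Connected :=
  { preconnected := fun x y => (col_reach_all hL x).symm.trans (col_reach_all hL y)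
    nonempty := ⟨fnColOrigin i₀ L⟩ }

end Loops

/-! ## §3 The whole Cayley graph is connected -/

/-- Every vertex lies in the column of half-width `1 + Σ_i |v_i|` (any free direction). [folklore] -/
theorem mem_fnCol_natAbs_sum (i₀ : Fin m) (x : FN m) : x ∈ fnCol i₀ (1 + ∑ i, (x.1 i).natAbs) := by
  intro i _
  have h1 : (x.1 i).natAbs ≤ ∑ j, (x.1 j).natAbs :=
    Finset.single_le_sum (f := fun j => (x.1 j).natAbs) (fun j _ => Nat.zero_le _) (Finset.mem_univ i)
  have h2 : |x.1 i| = ((x.1 i).natAbs : ℤ) := (Int.natCast_natAbs (x.1 i)).symm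
  rw [h2]
  have h3 : (x.1 i).natAbs ≤ 1 + ∑ j, (x.1 j).natAbs := by omega
  exact_mod_cast h3

/-- **`Cay(N_{m,2})` is connected.** [cite: BenjaminiSchramm1996, §2 (Cayley graphs)] -/
theorem fnGraph_connected (m : ℕ) : (fnGraph m).Connected := by
  refine { preconnected := fun x y => ?_, nonempty := ⟨0⟩ }
  rcases Nat.eq_zero_or_pos m with hm | hm
  · subst hm
    have : x = y := Prod.ext (funext fun i => i.elim0) (funext fun p => p.1.1.elim0)
    rw [this]
  · set i₀ : Fin m := ⟨0, hm⟩
    have hx := mem_fnCol_natAbs_sum i₀ x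
    have hy := mem_fnCol_natAbs_sum i₀ y
    have rx := (col_reach_all (i₀ := i₀) (L := 1 + ∑ i, (x.1 i).natAbs) (by omega) ⟨x, hx⟩).map
      (Embedding.induce (fnCol i₀ (1 + ∑ i, (x.1 i).natAbs))).toHom
    have ry := (col_reach_all (i₀ := i₀) (L := 1 + ∑ i, (y.1 i).natAbs) (by omega) ⟨y, hy⟩).map
      (Embedding.induce (fnCol i₀ (1 + ∑ i, (y.1 i).natAbs))).toHom
    exact rx.symm.trans ry

end Summit.CriticalPhenomena.PercolationContinuityZ3.Theorems.Transplant

end
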